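import Mathlib
import HarnessLib
import Summits.NavierStokesRegularity.NavierStokesRegularity.Theorems.TypeIQuarterGateScarEnvelopeTypeIForcedTsaiExactSwirlTail

/-!
# ARM B — DATUM B-2m at `J = 1`, kernel part (K3): the `|y|⁻³` COMPANION lowers the linearised
  residual of the swirl tail from `O(|y|⁻³)` to `O(|y|⁻⁵)` (ns-wall-extremal, eng-1 lineage g6, 2026-08-29)

WHAT IS PROVED (theorem-only; explicit fields; standard axioms).  With the two-term profile
`χ₁(σ) = σ⁻¹ + 2σ⁻²` (`σ = |y|²`; `χ₁ = r⁻² + 2r⁻⁴ = r^{−J−1}(1 + J(J+1)r⁻²)` at `J = 1`, the first two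
terms of the decaying Kummer branch `U(1, 5/2, r²/4) ∝ r⁻²(1 + 2r⁻² − 4r⁻⁴ + 24r⁻⁶ − …)`) and
`U(y) := χ₁(‖y‖²) • (y × e)`, for `x ≠ 0`:
* `laplacian_swirlTailCompanion` : `ΔU(x) = (−2(‖x‖²)^{−2} + 8(‖x‖²)^{−3})(x × e)`;
* `fderiv_swirlTailCompanion_apply_self` : `DU(x)[x] = −((‖x‖²)⁻¹ + 6(‖x‖²)^{−2})(x × e)`;
* ★ `swirlTailCompanion_linearisedResidual` :
  `−ΔU(x) + ½U(x) + ½DU(x)[x] = −8(‖x‖²)^{−3}(x × e)` — compare the bare tail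
  (`…ExactSwirlTail.swirlTail_linearisedResidual`: `+2(‖x‖²)^{−2}(x × e)`): the companion cancels the
  `|y|⁻³` order exactly and leaves `O(|y|⁻⁵)`, whose curl is `O(|y|⁻⁶)` — registered weight-5 density
  `O(|y|⁻⁷)`, integrable at infinity (idea-crit-7 g6 L6 (A) 04:25:37Z; B2J-CORRECTION.md §0 (c)).

MEANING.  The mechanism of DATUM B-2m (ns-wall-eng-2 g2) in the ONE swirl sector whose decaying mode
is not elementary (`J = 1`, pure differential rotation): CODE A's `asymptotic` closure imposes exactly
this companion (`c₁ = l(l+1) = 2`, nsdss/problem.py `asym_coeffs`), which is why the engines'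
truncated swirl floors equal the registered ones (B-2j v5: 18.903).  HONEST FRAME: pointwise identities
for explicit fields on `ℝ³ ∖ {0}`; linear order; nothing about the wall H3, crux `ScarEnvelopeTypeI`
(stmt-23843, OPEN) or Navier–Stokes regularity (NOT proved).
-/

noncomputable section

set_option linter.dupNamespace false

namespace Summit.NavierStokesRegularity.NavierStokesRegularity.Cruxes.ScarEnvelopeTypeI.ForcedTsai

namespace SwirlTail

open scoped Laplacian RealInnerProductSpace InnerProductSpace
open Literature.Analysis.FluidPDE Literature.Analysis.PDE Set Filter Topology

/-! ## The two-term companion-corrected swirl tail `(σ⁻¹ + 2σ⁻²)(y × e)` (DATUM B-2m at `J = 1`) -/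

/-- First derivative of the profile `χ₁(σ) = σ⁻¹ + 2σ⁻²` on `σ > 0`. -/
theorem hasDerivAt_chiJ1 {σ : ℝ} (hσ : 0 < σ) :
    HasDerivAt (fun s : ℝ => s ^ (-(1 : ℝ)) + 2 * s ^ (-(2 : ℝ)))
      (-(1 : ℝ) * σ ^ (-(1 : ℝ) - 1) + 2 * (-(2 : ℝ) * σ ^ (-(2 : ℝ) - 1))) σ := by
  have h1 := Real.hasDerivAt_rpow_const (x := σ) (p := -(1 : ℝ)) (Or.inl hσ.ne')
  have h2 := (Real.hasDerivAt_rpow_const (x := σ) (p := -(2 : ℝ)) (Or.inl hσ.ne')).const_mul 2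
  exact h1.add h2

/-- Second derivative of the profile `χ₁`. -/
theorem hasDerivAt_deriv_chiJ1 {σ : ℝ} (hσ : 0 < σ) :
    HasDerivAt (fun s : ℝ => -(1 : ℝ) * s ^ (-(1 : ℝ) - 1) + 2 * (-(2 : ℝ) * s ^ (-(2 : ℝ) - 1)))
      (-(1 : ℝ) * ((-(1 : ℝ) - 1) * σ ^ (-(1 : ℝ) - 1 - 1))
        + 2 * (-(2 : ℝ) * ((-(2 : ℝ) - 1) * σ ^ (-(2 : ℝ) - 1 - 1)))) σ := by
  have h1 := (Real.hasDerivAt_rpow_const (x := σ) (p := -(1 : ℝ) - 1) (Or.inl hσ.ne')).const_mul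
    (-(1 : ℝ))
  have h2 := ((Real.hasDerivAt_rpow_const (x := σ) (p := -(2 : ℝ) - 1)
    (Or.inl hσ.ne')).const_mul (-(2 : ℝ))).const_mul 2
  exact h1.add h2

/-- **Laplacian of the two-term tail**: `Δ[(σ⁻¹ + 2σ⁻²)(y × e)](x) = (−2(‖x‖²)^{−2} + 8(‖x‖²)^{−3})(x × e)`. -/
theorem laplacian_swirlTailCompanion (e : E3) {x : E3} (hx : x ≠ 0) :
    (Δ (fun y : E3 => ((‖y‖ ^ 2) ^ (-(1 : ℝ)) + 2 * (‖y‖ ^ 2) ^ (-(2 : ℝ))) • cross y e)) x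
      = (-2 * (‖x‖ ^ 2) ^ (-(2 : ℝ)) + 8 * (‖x‖ ^ 2) ^ (-(3 : ℝ))) • cross x e := by
  have hσ : 0 < ‖x‖ ^ 2 := by positivity
  have hr : ‖x‖ ≠ 0 := norm_ne_zero_iff.mpr hx
  set B := EuclideanSpace.basisFun (Fin 3) ℝ with hB
  have hφ : ContDiffAt ℝ 2 (fun y : E3 => (‖y‖ ^ 2) ^ (-(1 : ℝ)) + 2 * (‖y‖ ^ 2) ^ (-(2 : ℝ))) x := by
    have hσ' : (‖x‖ ^ 2) ≠ 0 := hσ.ne'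
    have h : ContDiffAt ℝ 2 (fun y : E3 => ‖y‖ ^ 2) x := (contDiff_norm_sq ℝ (E := E3)).contDiffAt
    exact (h.rpow_const_of_ne hσ').add (contDiffAt_const.mul (h.rpow_const_of_ne hσ'))
  have hg : ContDiffAt ℝ 2 (fun y : E3 => cross y e) x := by
    rw [cross_const_eq_flip]; exact (crossCLM.flip e).contDiff.contDiffAt
  rw [LoewnerNirenberg.laplacian_smul_apply hφ hg B]
  have hΔg : (Δ (fun y : E3 => cross y e)) x = 0 := by
    rw [cross_const_eq_flip]; exact laplacian_clm (crossCLM.flip e) x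
  have hg1 := hasDerivAt_chiJ1 hσ
  have hd1 : ∀ i, fderiv ℝ (fun y : E3 => (‖y‖ ^ 2) ^ (-(1 : ℝ)) + 2 * (‖y‖ ^ 2) ^ (-(2 : ℝ))) x (B i)
      = 2 * (-(1 : ℝ) * (‖x‖ ^ 2) ^ (-(1 : ℝ) - 1) + 2 * (-(2 : ℝ) * (‖x‖ ^ 2) ^ (-(2 : ℝ) - 1)))
        * ⟪x, B i⟫ := fun i =>
    fderiv_comp_norm_sq_apply (g := fun s : ℝ => s ^ (-(1 : ℝ)) + 2 * s ^ (-(2 : ℝ))) hg1 (B i)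
  have hdg : ∀ i, fderiv ℝ (fun y : E3 => cross y e) x (B i) = cross (B i) e := fun i => by
    rw [cross_const_eq_flip, show (fun y : E3 => (crossCLM.flip e) y) = ⇑(crossCLM.flip e) from rfl,
      (crossCLM.flip e).fderiv]
    simp
  have hsum : ∑ i, (fderiv ℝ (fun y : E3 => (‖y‖ ^ 2) ^ (-(1 : ℝ)) + 2 * (‖y‖ ^ 2) ^ (-(2 : ℝ))) x
      (B i)) • fderiv ℝ (fun y : E3 => cross y e) x (B i)
      = (2 * (-(1 : ℝ) * (‖x‖ ^ 2) ^ (-(1 : ℝ) - 1) + 2 * (-(2 : ℝ) * (‖x‖ ^ 2) ^ (-(2 : ℝ) - 1))))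
        • cross x e := by
    calc ∑ i, (fderiv ℝ (fun y : E3 => (‖y‖ ^ 2) ^ (-(1 : ℝ)) + 2 * (‖y‖ ^ 2) ^ (-(2 : ℝ))) x
          (B i)) • fderiv ℝ (fun y : E3 => cross y e) x (B i)
        = ∑ i, ((2 * (-(1 : ℝ) * (‖x‖ ^ 2) ^ (-(1 : ℝ) - 1) + 2 * (-(2 : ℝ) * (‖x‖ ^ 2) ^ (-(2 : ℝ) - 1))))
            * ⟪x, B i⟫) • cross (B i) e := Finset.sum_congr rfl fun i _ => by rw [hd1, hdg]
      _ = (2 * (-(1 : ℝ) * (‖x‖ ^ 2) ^ (-(1 : ℝ) - 1) + 2 * (-(2 : ℝ) * (‖x‖ ^ 2) ^ (-(2 : ℝ) - 1))))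
            • ∑ i, ⟪x, B i⟫ • cross (B i) e := by
          rw [Finset.smul_sum]
          exact Finset.sum_congr rfl fun i _ => by rw [mul_smul]
      _ = _ := by rw [sum_inner_smul_cross]
  have hΔφ : (Δ (fun y : E3 => ((‖y‖ ^ 2) ^ (-(1 : ℝ)) + 2 * (‖y‖ ^ 2) ^ (-(2 : ℝ)) : ℝ))) x
      = 4 * (-(1 : ℝ) * ((-(1 : ℝ) - 1) * (‖x‖ ^ 2) ^ (-(1 : ℝ) - 1 - 1))
          + 2 * (-(2 : ℝ) * ((-(2 : ℝ) - 1) * (‖x‖ ^ 2) ^ (-(2 : ℝ) - 1 - 1)))) * ‖x‖ ^ 2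
        + 2 * (3 : ℕ) * (-(1 : ℝ) * (‖x‖ ^ 2) ^ (-(1 : ℝ) - 1)
          + 2 * (-(2 : ℝ) * (‖x‖ ^ 2) ^ (-(2 : ℝ) - 1))) := by
    have key := laplacian_comp_norm_sq (E := E3)
      (g := fun s : ℝ => s ^ (-(1 : ℝ)) + 2 * s ^ (-(2 : ℝ)))
      (g₁ := fun s : ℝ => -(1 : ℝ) * s ^ (-(1 : ℝ) - 1) + 2 * (-(2 : ℝ) * s ^ (-(2 : ℝ) - 1)))
      isOpen_Ioi (fun s hs => hasDerivAt_chiJ1 hs) (z := x) hσ (hasDerivAt_deriv_chiJ1 hσ)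
    rw [key, finrank_euclideanSpace_fin]
  rw [hsum, hΔφ, hΔg, smul_zero, add_zero, smul_smul, ← add_smul]
  congr 1
  have e4 : (‖x‖ ^ 2) ^ (-(1 : ℝ) - 1) = (‖x‖⁻¹) ^ 4 := norm_sq_rpow_eq_inv_pow hx (by norm_num)
  have e6 : (‖x‖ ^ 2) ^ (-(2 : ℝ) - 1) = (‖x‖⁻¹) ^ 6 := norm_sq_rpow_eq_inv_pow hx (by norm_num)
  have e6' : (‖x‖ ^ 2) ^ (-(1 : ℝ) - 1 - 1) = (‖x‖⁻¹) ^ 6 := norm_sq_rpow_eq_inv_pow hx (by norm_num)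
  have e8 : (‖x‖ ^ 2) ^ (-(2 : ℝ) - 1 - 1) = (‖x‖⁻¹) ^ 8 := norm_sq_rpow_eq_inv_pow hx (by norm_num)
  have e4' : (‖x‖ ^ 2) ^ (-(2 : ℝ)) = (‖x‖⁻¹) ^ 4 := norm_sq_rpow_eq_inv_pow hx (by norm_num)
  have e6'' : (‖x‖ ^ 2) ^ (-(3 : ℝ)) = (‖x‖⁻¹) ^ 6 := norm_sq_rpow_eq_inv_pow hx (by norm_num)
  rw [e4, e6, e6', e8, e4', e6'']
  have hu : ‖x‖⁻¹ * ‖x‖ = 1 := inv_mul_cancel₀ hr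
  have h1 : (‖x‖⁻¹) ^ 6 * ‖x‖ ^ 2 = (‖x‖⁻¹) ^ 4 := by
    calc (‖x‖⁻¹) ^ 6 * ‖x‖ ^ 2 = (‖x‖⁻¹) ^ 4 * (‖x‖⁻¹ * ‖x‖) ^ 2 := by ring
      _ = (‖x‖⁻¹) ^ 4 := by rw [hu]; ring
  have h2 : (‖x‖⁻¹) ^ 8 * ‖x‖ ^ 2 = (‖x‖⁻¹) ^ 6 := by
    calc (‖x‖⁻¹) ^ 8 * ‖x‖ ^ 2 = (‖x‖⁻¹) ^ 6 * (‖x‖⁻¹ * ‖x‖) ^ 2 := by ring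
      _ = (‖x‖⁻¹) ^ 6 := by rw [hu]; ring
  push_cast
  linear_combination (8 : ℝ) * h1 + (48 : ℝ) * h2

/-- `DU(x)[x] = −((‖x‖²)⁻¹ + 6(‖x‖²)^{−2})(x × e)` for the two-term tail (product rule; `y × e` has
degree 1). -/
theorem fderiv_swirlTailCompanion_apply_self (e : E3) {x : E3} (hx : x ≠ 0) :
    fderiv ℝ (fun y : E3 => ((‖y‖ ^ 2) ^ (-(1 : ℝ)) + 2 * (‖y‖ ^ 2) ^ (-(2 : ℝ))) • cross y e) x x
      = (-((‖x‖ ^ 2) ^ (-(1 : ℝ)) + 6 * (‖x‖ ^ 2) ^ (-(2 : ℝ)))) • cross x e := by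
  have hσ : 0 < ‖x‖ ^ 2 := by positivity
  have hr : ‖x‖ ≠ 0 := norm_ne_zero_iff.mpr hx
  have hφ := hasFDerivAt_comp_norm_sq (E := E3)
    (g := fun s : ℝ => s ^ (-(1 : ℝ)) + 2 * s ^ (-(2 : ℝ))) (hasDerivAt_chiJ1 hσ)
  have hc : HasFDerivAt (fun y : E3 => cross y e) (crossCLM.flip e) x := by
    rw [cross_const_eq_flip]; exact (crossCLM.flip e).hasFDerivAt
  have hU : HasFDerivAt (fun y : E3 => ((‖y‖ ^ 2) ^ (-(1 : ℝ)) + 2 * (‖y‖ ^ 2) ^ (-(2 : ℝ))) • cross y e)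
      (((‖x‖ ^ 2) ^ (-(1 : ℝ)) + 2 * (‖x‖ ^ 2) ^ (-(2 : ℝ))) • crossCLM.flip e
        + ((2 * (-(1 : ℝ) * (‖x‖ ^ 2) ^ (-(1 : ℝ) - 1) + 2 * (-(2 : ℝ) * (‖x‖ ^ 2) ^ (-(2 : ℝ) - 1))))
            • (innerSL ℝ x : E3 →L[ℝ] ℝ)).smulRight (cross x e)) x := hφ.smul hc
  rw [hU.fderiv]
  simp only [add_apply, smul_apply, ContinuousLinearMap.smulRight_apply, ContinuousLinearMap.flip_apply,
    crossCLM_apply, innerSL_apply_apply, real_inner_self_eq_norm_sq, ← add_smul]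
  congr 1
  have e2 : (‖x‖ ^ 2) ^ (-(1 : ℝ)) = (‖x‖⁻¹) ^ 2 := norm_sq_rpow_eq_inv_pow hx (by norm_num)
  have e4 : (‖x‖ ^ 2) ^ (-(1 : ℝ) - 1) = (‖x‖⁻¹) ^ 4 := norm_sq_rpow_eq_inv_pow hx (by norm_num)
  have e4' : (‖x‖ ^ 2) ^ (-(2 : ℝ)) = (‖x‖⁻¹) ^ 4 := norm_sq_rpow_eq_inv_pow hx (by norm_num)
  have e6 : (‖x‖ ^ 2) ^ (-(2 : ℝ) - 1) = (‖x‖⁻¹) ^ 6 := norm_sq_rpow_eq_inv_pow hx (by norm_num)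
  rw [e2, e4, e4', e6]
  have hu : ‖x‖⁻¹ * ‖x‖ = 1 := inv_mul_cancel₀ hr
  have h1 : (‖x‖⁻¹) ^ 4 * ‖x‖ ^ 2 = (‖x‖⁻¹) ^ 2 := by
    calc (‖x‖⁻¹) ^ 4 * ‖x‖ ^ 2 = (‖x‖⁻¹) ^ 2 * (‖x‖⁻¹ * ‖x‖) ^ 2 := by ring
      _ = (‖x‖⁻¹) ^ 2 := by rw [hu]; ring
  have h2 : (‖x‖⁻¹) ^ 6 * ‖x‖ ^ 2 = (‖x‖⁻¹) ^ 4 := by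
    calc (‖x‖⁻¹) ^ 6 * ‖x‖ ^ 2 = (‖x‖⁻¹) ^ 4 * (‖x‖⁻¹ * ‖x‖) ^ 2 := by ring
      _ = (‖x‖⁻¹) ^ 4 := by rw [hu]; ring
  linear_combination (-2 : ℝ) * h1 + (-8 : ℝ) * h2

/-- ★ **The `|y|⁻³` companion lowers the linearised residual of the swirl tail by two orders**:
for `U(y) = ((‖y‖²)⁻¹ + 2(‖y‖²)^{−2})(y × e)` (`χ = r⁻² + 2r⁻⁴`, the first two terms of the
decaying Kummer branch `r⁻²(1 + 2r⁻² − 4r⁻⁴ + …)` of DATUM B-2m at `J = 1`) and `x ≠ 0`,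
`−ΔU(x) + ½U(x) + ½DU(x)[x] = −8(‖x‖²)^{−3}(x × e)` — residual `O(|y|⁻⁵)` instead of the bare tail's
`2(x × e)/|y|⁴ = O(|y|⁻³)` (`swirlTail_linearisedResidual`); its curl is `O(|y|⁻⁶)`, so the registered
weight-5 density is `O(|y|⁻⁷)` and integrable at infinity (idea-crit-7 g6 L6 (A)). -/
theorem swirlTailCompanion_linearisedResidual (e : E3) {x : E3} (hx : x ≠ 0) :
    -((Δ (fun y : E3 => ((‖y‖ ^ 2) ^ (-(1 : ℝ)) + 2 * (‖y‖ ^ 2) ^ (-(2 : ℝ))) • cross y e)) x)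
      + (1 / 2 : ℝ) • (((‖x‖ ^ 2) ^ (-(1 : ℝ)) + 2 * (‖x‖ ^ 2) ^ (-(2 : ℝ))) • cross x e)
      + (1 / 2 : ℝ) • fderiv ℝ (fun y : E3 => ((‖y‖ ^ 2) ^ (-(1 : ℝ)) + 2 * (‖y‖ ^ 2) ^ (-(2 : ℝ))) •
          cross y e) x x
      = (-8 * (‖x‖ ^ 2) ^ (-(3 : ℝ))) • cross x e := by
  rw [laplacian_swirlTailCompanion e hx, fderiv_swirlTailCompanion_apply_self e hx, smul_smul, smul_smul,
    ← neg_smul, ← add_smul, ← add_smul]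
  congr 1
  ring

end SwirlTail

end Summit.NavierStokesRegularity.NavierStokesRegularity.Cruxes.ScarEnvelopeTypeI.ForcedTsai

end
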